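import Mathlib.Analysis.Distribution.SchwartzSpace.Basic
import Mathlib.Analysis.Calculus.MeanValue
import Mathlib.Analysis.Normed.Module.Multilinear.Basic
import HarnessLib

/-!
# Schwartz space: parametric continuity under linear automorphisms, growth of translates

Generic Schwartz-space estimates (no physics content; all declarations are deliberate
`SchwartzMap` API extensions in upstream-ready form, hence in the `SchwartzMap` namespace),
companions of
`Literature.MathematicalPhysics.QuantumLattice.continuous_compSubConstCLM` (`Literature.MathematicalPhysics.QuantumLattice.SchwartzTranslationCutoff`,
continuity of `a ↦ f(· - a)`):

* `SchwartzMap.continuous_compCLMOfContinuousLinearEquiv_apply`: for `f ∈ 𝒮(V)` the map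
  `x ↦ f ∘ Φ x` is continuous into `𝒮(V)` along any family of linear automorphisms `Φ` that is
  continuous in operator norm (pointwise estimate
  `SchwartzMap.pow_mul_norm_iteratedFDeriv_comp_sub_comp_le`: mean value inequality for `Dⁿf`
  on the segment `[A₀ y, A y]` plus continuity of
  `ContinuousMultilinearMap.compContinuousLinearMapContinuousMultilinear`); used for the strong
  continuity of Lorentz transformations in the Wightman reconstruction
  (`Literature.Analysis.FunctionSpaces.WightmanGNSContinuity`).
* `SchwartzMap.seminorm_compSubConstCLM_le`: seminorms of a translate grow polynomially in the
  translation vector, `‖f(· - v)‖_{k,n} ≤ 2^k (1 + ‖v‖)^k (‖f‖_{k,n} + ‖f‖_{0,n})`, and the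
  derived polynomial bound for images of translates under a continuous linear map of Schwartz
  spaces (`SchwartzMap.exists_seminorm_clm_compSubConstCLM_le`).
* `SchwartzMap.integrable_one_add_norm_pow_mul`: `(1 + ‖a‖)^N ‖h(a)‖` is integrable for
  Schwartz `h`.

## References
* L. Hörmander, The Analysis of Linear Partial Differential Operators I (1983), §7.1
  (the Schwartz space and its topology).
* R. F. Streater, A. S. Wightman, PCT, Spin and Statistics, and All That (1964), §2-1.
-/

noncomputable section

open Filter Topology MeasureTheory
open scoped SchwartzMap ContDiff

namespace SchwartzMap

/-! ### Composition with linear automorphisms depends continuously on the automorphism -/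

section LinearComp

variable (𝕜 : Type*) [RCLike 𝕜]
variable {V : Type*} [NormedAddCommGroup V] [NormedSpace ℝ V]
variable {F : Type*} [NormedAddCommGroup F] [NormedSpace ℝ F] [NormedSpace 𝕜 F] [SMulCommClass ℝ 𝕜 F]

omit [SMulCommClass ℝ 𝕜 F] in
/-- Derivatives of `f ∘ A` for a linear automorphism `A`. [folklore] -/
theorem iteratedFDeriv_compCLMOfContinuousLinearEquiv (f : 𝓢(V, F)) (A : V ≃L[ℝ] V) (n : ℕ)
    (y : V) :
    iteratedFDeriv ℝ n (compCLMOfContinuousLinearEquiv 𝕜 A f) y =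
      (iteratedFDeriv ℝ n f (A y)).compContinuousLinearMap fun _ => (A : V →L[ℝ] V) := by
  rw [compCLMOfContinuousLinearEquiv_apply]
  exact (A : V →L[ℝ] V).iteratedFDeriv_comp_right (f.smooth ⊤) y (mod_cast le_top)

omit [NormedSpace 𝕜 F] [SMulCommClass ℝ 𝕜 F] in
/-- `compContinuousLinearMap` is additive in the multilinear map (`map_sub` of Mathlib's
`compContinuousLinearMapL`, in the pointwise form used below). [folklore] -/
private theorem sub_compContinuousLinearMap {n : ℕ} (m m' : ContinuousMultilinearMap ℝ (fun _ : Fin n => V) F)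
    (g : Fin n → V →L[ℝ] V) :
    (m - m').compContinuousLinearMap g =
      m.compContinuousLinearMap g - m'.compContinuousLinearMap g := by
  ext v; simp

/-- **Pointwise estimate for `f ∘ A - f ∘ A₀`**: for `‖A - A₀‖ ‖A₀⁻¹‖ ≤ 1/2`,
`‖y‖^k ‖Dⁿ(f∘A - f∘A₀)(y)‖ ≤ c ‖A‖ⁿ ‖A - A₀‖ + c₂ ‖𝔐(A,…,A) - 𝔐(A₀,…,A₀)‖` with the
constants `c = (1 + 2‖A₀⁻¹‖)^{k+1} 2^{k+1} sup_{≤ (k+1,n+1)} ‖f‖`, `c₂ = ‖A₀⁻¹‖^k ‖f‖_{k,n}` and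
`𝔐 = compContinuousLinearMapContinuousMultilinear` (mean value inequality on the segment
`[A₀ y, A y]`, on which `1 + ‖y‖ ≤ (1 + 2‖A₀⁻¹‖)(1 + ‖z‖)`). [folklore] -/
theorem pow_mul_norm_iteratedFDeriv_comp_sub_comp_le (f : 𝓢(V, F)) (k n : ℕ)
    (A A₀ : V ≃L[ℝ] V)
    (hA : ‖(A : V →L[ℝ] V) - A₀‖ * ‖(A₀.symm : V →L[ℝ] V)‖ ≤ 1 / 2) (y : V) :
    ‖y‖ ^ k * ‖iteratedFDeriv ℝ n
        (compCLMOfContinuousLinearEquiv 𝕜 A f - compCLMOfContinuousLinearEquiv 𝕜 A₀ f) y‖ ≤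
      ((1 + 2 * ‖(A₀.symm : V →L[ℝ] V)‖) ^ (k + 1) * (2 ^ (k + 1) *
          ((Finset.Iic (k + 1, n + 1)).sup fun m => SchwartzMap.seminorm 𝕜 m.1 m.2) f)) *
        ‖(A : V →L[ℝ] V)‖ ^ n * ‖(A : V →L[ℝ] V) - A₀‖ +
      ‖(A₀.symm : V →L[ℝ] V)‖ ^ k * SchwartzMap.seminorm 𝕜 k n f *
        ‖ContinuousMultilinearMap.compContinuousLinearMapContinuousMultilinear ℝ
            (fun _ : Fin n => V) (fun _ : Fin n => V) F (fun _ => (A : V →L[ℝ] V)) -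
          ContinuousMultilinearMap.compContinuousLinearMapContinuousMultilinear ℝ
            (fun _ : Fin n => V) (fun _ : Fin n => V) F (fun _ => (A₀ : V →L[ℝ] V))‖ := by
  set N₀ : ℝ := ‖(A₀.symm : V →L[ℝ] V)‖
  set S : ℝ := 2 ^ (k + 1) * ((Finset.Iic (k + 1, n + 1)).sup fun m => SchwartzMap.seminorm 𝕜 m.1 m.2) f
  set c : ℝ := (1 + 2 * N₀) ^ (k + 1) * S
  set 𝔐 := ContinuousMultilinearMap.compContinuousLinearMapContinuousMultilinear ℝ
    (fun _ : Fin n => V) (fun _ : Fin n => V) F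
  have hS : 0 ≤ S := by positivity
  have hc : 0 ≤ c := by positivity
  -- the two multilinear maps
  set m : ContinuousMultilinearMap ℝ (fun _ : Fin n => V) F := iteratedFDeriv ℝ n f (A y)
  set m₀ : ContinuousMultilinearMap ℝ (fun _ : Fin n => V) F := iteratedFDeriv ℝ n f (A₀ y)
  have hsmooth : ∀ A' : V ≃L[ℝ] V, ContDiff ℝ ∞ (compCLMOfContinuousLinearEquiv 𝕜 A' f) :=
    fun A' => (compCLMOfContinuousLinearEquiv 𝕜 A' f).smooth ⊤
  have hderiv : iteratedFDeriv ℝ n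
      (compCLMOfContinuousLinearEquiv 𝕜 A f - compCLMOfContinuousLinearEquiv 𝕜 A₀ f) y =
      (m - m₀).compContinuousLinearMap (fun _ => (A : V →L[ℝ] V)) + (𝔐 (fun _ => (A : V →L[ℝ] V)) - 𝔐 (fun _ => (A₀ : V →L[ℝ] V))) m₀ := by
    have hfun : ⇑(compCLMOfContinuousLinearEquiv 𝕜 A f - compCLMOfContinuousLinearEquiv 𝕜 A₀ f) =
        ⇑(compCLMOfContinuousLinearEquiv 𝕜 A f) - ⇑(compCLMOfContinuousLinearEquiv 𝕜 A₀ f) := rfl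
    rw [hfun, iteratedFDeriv_sub_apply ((hsmooth A).contDiffAt.of_le (mod_cast le_top))
      ((hsmooth A₀).contDiffAt.of_le (mod_cast le_top)),
      iteratedFDeriv_compCLMOfContinuousLinearEquiv, iteratedFDeriv_compCLMOfContinuousLinearEquiv]
    simp only [sub_apply,
      ContinuousMultilinearMap.compContinuousLinearMapContinuousMultilinear_apply_apply, m, m₀, 𝔐,
      sub_compContinuousLinearMap]
    abel
  -- `‖y‖ ≤ N₀ ‖A₀ y‖`
  have hyN : ‖y‖ ≤ N₀ * ‖A₀ y‖ := by
    calc ‖y‖ = ‖(A₀.symm : V →L[ℝ] V) (A₀ y)‖ := by simp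
      _ ≤ N₀ * ‖A₀ y‖ := ContinuousLinearMap.le_opNorm _ _
  -- first term: mean value inequality
  have key : ∀ z ∈ segment ℝ (A₀ y) (A y),
      ‖fderiv ℝ (iteratedFDeriv ℝ n f) z‖ ≤ c / (1 + ‖y‖) ^ (k + 1) := by
    intro z hz
    have hpos : 0 < (1 + ‖y‖) ^ (k + 1) := by positivity
    rw [norm_fderiv_iteratedFDeriv, le_div_iff₀ hpos]
    have hz1 : ‖A₀ y - z‖ ≤ ‖((A : V →L[ℝ] V) - A₀) y‖ := by
      rw [norm_sub_rev]
      refine (_root_.norm_sub_le_of_mem_segment hz).trans (le_of_eq ?_)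
      rw [sub_apply]
      rfl
    have hy2 : ‖y‖ ≤ 2 * N₀ * ‖z‖ := by
      have h1 : ‖A₀ y‖ ≤ ‖z‖ + ‖((A : V →L[ℝ] V) - A₀) y‖ := by
        calc ‖A₀ y‖ = ‖z + (A₀ y - z)‖ := by rw [add_sub_cancel]
          _ ≤ ‖z‖ + ‖A₀ y - z‖ := norm_add_le _ _
          _ ≤ ‖z‖ + ‖((A : V →L[ℝ] V) - A₀) y‖ := by gcongr
      have h2 : ‖((A : V →L[ℝ] V) - A₀) y‖ ≤ ‖(A : V →L[ℝ] V) - A₀‖ * ‖y‖ := ContinuousLinearMap.le_opNorm _ _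
      have h3 : N₀ * (‖(A : V →L[ℝ] V) - A₀‖ * ‖y‖) ≤ ‖y‖ / 2 := by
        calc N₀ * (‖(A : V →L[ℝ] V) - A₀‖ * ‖y‖) = (‖(A : V →L[ℝ] V) - A₀‖ * N₀) * ‖y‖ := by ring
          _ ≤ (1 / 2) * ‖y‖ := by gcongr
          _ = ‖y‖ / 2 := by ring
      have hN₀ : 0 ≤ N₀ := norm_nonneg _
      nlinarith [norm_nonneg z, norm_nonneg y]
    have h1y : 1 + ‖y‖ ≤ (1 + 2 * N₀) * (1 + ‖z‖) := by
      have hN₀ : 0 ≤ N₀ := norm_nonneg _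
      nlinarith [norm_nonneg z]
    calc ‖iteratedFDeriv ℝ (n + 1) f z‖ * (1 + ‖y‖) ^ (k + 1)
        ≤ ‖iteratedFDeriv ℝ (n + 1) f z‖ * ((1 + 2 * N₀) * (1 + ‖z‖)) ^ (k + 1) := by gcongr
      _ = (1 + 2 * N₀) ^ (k + 1) * ((1 + ‖z‖) ^ (k + 1) * ‖iteratedFDeriv ℝ (n + 1) f z‖) := by
          rw [mul_pow]; ring
      _ ≤ (1 + 2 * N₀) ^ (k + 1) * S := by
          gcongr
          exact one_add_le_sup_seminorm_apply (𝕜 := 𝕜) (m := (k + 1, n + 1)) le_rfl le_rfl f z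
  have hdiff : ∀ z ∈ segment ℝ (A₀ y) (A y), DifferentiableAt ℝ (iteratedFDeriv ℝ n f) z :=
    fun z _ => ((f.smooth ⊤).differentiable_iteratedFDeriv (mod_cast ENat.coe_lt_top n)) z
  have mvt := Convex.norm_image_sub_le_of_norm_fderiv_le hdiff key (convex_segment _ _)
    (left_mem_segment _ _ _) (right_mem_segment _ _ _)
  -- `mvt : ‖m - m₀‖ ≤ c / (1+‖y‖)^(k+1) * ‖A y - A₀ y‖`
  have hmm₀ : ‖y‖ ^ k * ‖m - m₀‖ ≤ c * ‖(A : V →L[ℝ] V) - A₀‖ := by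
    have h1 : ‖A y - A₀ y‖ ≤ ‖(A : V →L[ℝ] V) - A₀‖ * ‖y‖ := by
      have := ((A : V →L[ℝ] V) - A₀).le_opNorm y
      rwa [sub_apply] at this
    have hpos : 0 < (1 + ‖y‖) ^ (k + 1) := by positivity
    have hyk : ‖y‖ ^ k * ‖y‖ ≤ (1 + ‖y‖) ^ (k + 1) := by
      rw [← pow_succ]
      exact pow_le_pow_left₀ (norm_nonneg _) (by linarith [norm_nonneg y]) _
    calc ‖y‖ ^ k * ‖m - m₀‖ ≤ ‖y‖ ^ k * (c / (1 + ‖y‖) ^ (k + 1) * (‖(A : V →L[ℝ] V) - A₀‖ * ‖y‖)) := by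
          gcongr
          exact mvt.trans (by gcongr)
      _ = c * ‖(A : V →L[ℝ] V) - A₀‖ * ((‖y‖ ^ k * ‖y‖) / (1 + ‖y‖) ^ (k + 1)) := by
          field_simp
      _ ≤ c * ‖(A : V →L[ℝ] V) - A₀‖ * 1 := by
          gcongr
          rw [div_le_one hpos]
          exact hyk
      _ = c * ‖(A : V →L[ℝ] V) - A₀‖ := mul_one _
  -- second term
  have hm₀ : ‖y‖ ^ k * ‖m₀‖ ≤ N₀ ^ k * SchwartzMap.seminorm 𝕜 k n f := by
    calc ‖y‖ ^ k * ‖m₀‖ ≤ (N₀ * ‖A₀ y‖) ^ k * ‖m₀‖ := by gcongr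
      _ = N₀ ^ k * (‖A₀ y‖ ^ k * ‖iteratedFDeriv ℝ n f (A₀ y)‖) := by rw [mul_pow]; ring
      _ ≤ N₀ ^ k * SchwartzMap.seminorm 𝕜 k n f := by
          gcongr
          exact le_seminorm 𝕜 k n f _
  -- assemble
  rw [hderiv]
  calc ‖y‖ ^ k * ‖(m - m₀).compContinuousLinearMap (fun _ => (A : V →L[ℝ] V)) + (𝔐 (fun _ => (A : V →L[ℝ] V)) - 𝔐 (fun _ => (A₀ : V →L[ℝ] V))) m₀‖
      ≤ ‖y‖ ^ k * (‖(m - m₀).compContinuousLinearMap (fun _ => (A : V →L[ℝ] V))‖ +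
          ‖(𝔐 (fun _ => (A : V →L[ℝ] V)) - 𝔐 (fun _ => (A₀ : V →L[ℝ] V))) m₀‖) := by
        gcongr; exact norm_add_le _ _
    _ ≤ ‖y‖ ^ k * (‖m - m₀‖ * ‖(A : V →L[ℝ] V)‖ ^ n + ‖𝔐 (fun _ => (A : V →L[ℝ] V)) - 𝔐 (fun _ => (A₀ : V →L[ℝ] V))‖ * ‖m₀‖) := by
        gcongr
        · refine (ContinuousMultilinearMap.norm_compContinuousLinearMap_le _ _).trans ?_
          simp
        · exact ContinuousLinearMap.le_opNorm _ _
    _ = (‖y‖ ^ k * ‖m - m₀‖) * ‖(A : V →L[ℝ] V)‖ ^ n + ‖𝔐 (fun _ => (A : V →L[ℝ] V)) - 𝔐 (fun _ => (A₀ : V →L[ℝ] V))‖ * (‖y‖ ^ k * ‖m₀‖) := by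
        ring
    _ ≤ (c * ‖(A : V →L[ℝ] V) - A₀‖) * ‖(A : V →L[ℝ] V)‖ ^ n +
        ‖𝔐 (fun _ => (A : V →L[ℝ] V)) - 𝔐 (fun _ => (A₀ : V →L[ℝ] V))‖ * (N₀ ^ k * SchwartzMap.seminorm 𝕜 k n f) := by
        gcongr
    _ = _ := by ring

/-- **Composition with a continuously varying linear automorphism is continuous on Schwartz
space**: if `x ↦ Φ x` is continuous in operator norm then `x ↦ f ∘ Φ x` is continuous
`X → 𝒮(V, F)`. [folklore] -/
theorem continuous_compCLMOfContinuousLinearEquiv_apply {X : Type*} [TopologicalSpace X]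
    (Φ : X → (V ≃L[ℝ] V)) (hΦ : Continuous fun x => (Φ x : V →L[ℝ] V)) (f : 𝓢(V, F)) :
    Continuous fun x => compCLMOfContinuousLinearEquiv 𝕜 (Φ x) f := by
  refine continuous_iff_continuousAt.2 fun x₀ => ?_
  rw [ContinuousAt, (schwartz_withSeminorms 𝕜 V F).tendsto_nhds]
  rintro ⟨k, n⟩ ε hε
  set A₀ := Φ x₀
  set N₀ : ℝ := ‖(A₀.symm : V →L[ℝ] V)‖
  set c : ℝ := (1 + 2 * N₀) ^ (k + 1) * (2 ^ (k + 1) *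
    ((Finset.Iic (k + 1, n + 1)).sup fun m => SchwartzMap.seminorm 𝕜 m.1 m.2) f)
  set c₂ : ℝ := N₀ ^ k * SchwartzMap.seminorm 𝕜 k n f
  set 𝔐 := ContinuousMultilinearMap.compContinuousLinearMapContinuousMultilinear ℝ
    (fun _ : Fin n => V) (fun _ : Fin n => V) F
  set q : X → ℝ := fun x => c * ‖(Φ x : V →L[ℝ] V)‖ ^ n * ‖(Φ x : V →L[ℝ] V) - A₀‖ +
    c₂ * ‖𝔐 (fun _ => (Φ x : V →L[ℝ] V)) - 𝔐 (fun _ => (A₀ : V →L[ℝ] V))‖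
  have h1 : Tendsto (fun x => (Φ x : V →L[ℝ] V)) (𝓝 x₀) (𝓝 (A₀ : V →L[ℝ] V)) := hΦ.tendsto x₀
  have h2 : Tendsto (fun x => ‖(Φ x : V →L[ℝ] V) - A₀‖) (𝓝 x₀) (𝓝 0) :=
    tendsto_iff_norm_sub_tendsto_zero.1 h1
  have hq : Tendsto q (𝓝 x₀) (𝓝 0) := by
    have h3 : Tendsto (fun x => 𝔐 fun _ => (Φ x : V →L[ℝ] V)) (𝓝 x₀)
        (𝓝 (𝔐 fun _ => (A₀ : V →L[ℝ] V))) :=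
      (𝔐.cont.tendsto _).comp (tendsto_pi_nhds.2 fun _ => h1)
    have h4 := tendsto_iff_norm_sub_tendsto_zero.1 h3
    have h5 : Tendsto (fun x => ‖(Φ x : V →L[ℝ] V)‖ ^ n) (𝓝 x₀) (𝓝 (‖(A₀ : V →L[ℝ] V)‖ ^ n)) :=
      h1.norm.pow n
    have := ((h5.mul h2).const_mul c).add (h4.const_mul c₂)
    simpa [q, mul_assoc] using this
  have hsmall : ∀ᶠ x in 𝓝 x₀, ‖(Φ x : V →L[ℝ] V) - A₀‖ * N₀ ≤ 1 / 2 := by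
    have h6 : Tendsto (fun x => ‖(Φ x : V →L[ℝ] V) - A₀‖ * N₀) (𝓝 x₀) (𝓝 0) := by
      simpa using h2.mul_const N₀
    exact (h6.eventually (ge_mem_nhds (by norm_num : (0 : ℝ) < 1 / 2)))
  filter_upwards [hsmall, (tendsto_order.1 hq).2 ε hε] with x hx hqx
  refine lt_of_le_of_lt ?_ hqx
  exact SchwartzMap.seminorm_le_bound 𝕜 k n _ (by positivity) fun y =>
    pow_mul_norm_iteratedFDeriv_comp_sub_comp_le 𝕜 f k n (Φ x) A₀ hx y

end LinearComp

/-! ## Seminorm growth of translates and integrability of Schwartz weights -/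

section Growth

variable {V : Type*} [NormedAddCommGroup V] [NormedSpace ℝ V]

/-- **Seminorms of a translate grow polynomially in the translation vector**:
`‖f(· - v)‖_{k,n} ≤ 2^k (1 + ‖v‖)^k (‖f‖_{k,n} + ‖f‖_{0,n})`. [folklore] -/
theorem seminorm_compSubConstCLM_le (f : 𝓢(V, ℂ)) (k n : ℕ) (v : V) :
    SchwartzMap.seminorm ℂ k n (SchwartzMap.compSubConstCLM ℂ v f) ≤
      2 ^ k * (1 + ‖v‖) ^ k * (SchwartzMap.seminorm ℂ k n f + SchwartzMap.seminorm ℂ 0 n f) := by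
  refine SchwartzMap.seminorm_le_bound ℂ k n _ (by positivity) fun x => ?_
  have hfun : ⇑(SchwartzMap.compSubConstCLM ℂ v f) = fun y => f (y - v) := rfl
  rw [hfun, iteratedFDeriv_comp_sub]
  have h1 : ‖x‖ ≤ ‖x - v‖ + ‖v‖ := by
    calc ‖x‖ = ‖(x - v) + v‖ := by rw [sub_add_cancel]
      _ ≤ ‖x - v‖ + ‖v‖ := norm_add_le _ _
  have h2 : ‖x‖ ^ k ≤ 2 ^ k * (‖x - v‖ ^ k + ‖v‖ ^ k) :=
    (pow_le_pow_left₀ (norm_nonneg _) h1 k).trans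
      ((add_pow_le (norm_nonneg _) (norm_nonneg _) k).trans (by gcongr <;> norm_num))
  have hA : ‖x - v‖ ^ k * ‖iteratedFDeriv ℝ n f (x - v)‖ ≤ SchwartzMap.seminorm ℂ k n f :=
    SchwartzMap.le_seminorm ℂ k n f _
  have hB : ‖iteratedFDeriv ℝ n f (x - v)‖ ≤ SchwartzMap.seminorm ℂ 0 n f :=
    SchwartzMap.norm_iteratedFDeriv_le_seminorm ℂ f n _
  have hv : ‖v‖ ^ k ≤ (1 + ‖v‖) ^ k := pow_le_pow_left₀ (norm_nonneg _) (by linarith [norm_nonneg v]) k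
  have h1v : (1 : ℝ) ≤ (1 + ‖v‖) ^ k := one_le_pow₀ (by linarith [norm_nonneg v])
  have hC : ‖v‖ ^ k * ‖iteratedFDeriv ℝ n f (x - v)‖ ≤ (1 + ‖v‖) ^ k * SchwartzMap.seminorm ℂ 0 n f :=
    mul_le_mul hv hB (norm_nonneg _) (by positivity)
  have hD : SchwartzMap.seminorm ℂ k n f ≤ (1 + ‖v‖) ^ k * SchwartzMap.seminorm ℂ k n f :=
    le_mul_of_one_le_left (apply_nonneg _ _) h1v
  calc ‖x‖ ^ k * ‖iteratedFDeriv ℝ n f (x - v)‖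
      ≤ 2 ^ k * (‖x - v‖ ^ k + ‖v‖ ^ k) * ‖iteratedFDeriv ℝ n f (x - v)‖ := by gcongr
    _ = 2 ^ k * (‖x - v‖ ^ k * ‖iteratedFDeriv ℝ n f (x - v)‖ +
          ‖v‖ ^ k * ‖iteratedFDeriv ℝ n f (x - v)‖) := by ring
    _ ≤ 2 ^ k * ((1 + ‖v‖) ^ k * SchwartzMap.seminorm ℂ k n f +
          (1 + ‖v‖) ^ k * SchwartzMap.seminorm ℂ 0 n f) := by
        have := add_le_add (hA.trans hD) hC
        exact mul_le_mul_of_nonneg_left this (by positivity)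
    _ = _ := by ring

/-- **Polynomial seminorm growth of the image of translates under a continuous linear map of
Schwartz spaces**: for `Λ : 𝒮(V) →L 𝒮(W)` and a linear `v : E → V`,
`‖Λ (f(· - v a))‖_{k,n} ≤ C (1 + ‖a‖)^N`. [folklore] -/
theorem exists_seminorm_clm_compSubConstCLM_le {W : Type*} [NormedAddCommGroup W] [NormedSpace ℝ W]
    {E : Type*} [NormedAddCommGroup E] [NormedSpace ℝ E]
    (Λ : 𝓢(V, ℂ) →L[ℂ] 𝓢(W, ℂ)) (f : 𝓢(V, ℂ)) (v : E →L[ℝ] V) (k n : ℕ) :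
    ∃ (C : ℝ) (N : ℕ), ∀ a : E,
      SchwartzMap.seminorm ℂ k n (Λ (SchwartzMap.compSubConstCLM ℂ (v a) f)) ≤ C * (1 + ‖a‖) ^ N := by
  set q : Seminorm ℂ 𝓢(V, ℂ) := (SchwartzMap.seminorm ℂ k n).comp Λ.toLinearMap
  have hq : Continuous q :=
    ((schwartz_withSeminorms ℂ W ℂ).continuous_seminorm (k, n)).comp Λ.continuous
  obtain ⟨s, C, _, hle⟩ := Seminorm.bound_of_continuous (schwartz_withSeminorms ℂ V ℂ) q hq
  set K : ℕ := s.sup Prod.fst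
  set Cf : ℝ := ∑ i ∈ s, 2 ^ i.1 * (SchwartzMap.seminorm ℂ i.1 i.2 f + SchwartzMap.seminorm ℂ 0 i.2 f)
  refine ⟨C * (Cf * (1 + ‖v‖) ^ K), K, fun a => ?_⟩
  have h1 : SchwartzMap.seminorm ℂ k n (Λ (SchwartzMap.compSubConstCLM ℂ (v a) f)) =
      q (SchwartzMap.compSubConstCLM ℂ (v a) f) := rfl
  rw [h1]
  refine (hle _).trans ?_
  change C • (s.sup (schwartzSeminormFamily ℂ V ℂ)) (SchwartzMap.compSubConstCLM ℂ (v a) f) ≤ _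
  rw [NNReal.smul_def, smul_eq_mul, mul_assoc]
  gcongr
  have hva : ‖v a‖ ≤ ‖v‖ * ‖a‖ := v.le_opNorm a
  have h1va : 1 + ‖v a‖ ≤ (1 + ‖v‖) * (1 + ‖a‖) := by
    have := norm_nonneg v; have := norm_nonneg a
    nlinarith
  calc (s.sup (schwartzSeminormFamily ℂ V ℂ)) (SchwartzMap.compSubConstCLM ℂ (v a) f)
      ≤ ∑ i ∈ s, 2 ^ i.1 * (1 + ‖v a‖) ^ i.1 *
          (SchwartzMap.seminorm ℂ i.1 i.2 f + SchwartzMap.seminorm ℂ 0 i.2 f) := by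
        refine Seminorm.finset_sup_apply_le (by positivity) fun i hi => ?_
        rw [SchwartzMap.schwartzSeminormFamily_apply]
        refine (seminorm_compSubConstCLM_le f i.1 i.2 (v a)).trans ?_
        exact Finset.single_le_sum (f := fun i : ℕ × ℕ => 2 ^ i.1 * (1 + ‖v a‖) ^ i.1 *
          (SchwartzMap.seminorm ℂ i.1 i.2 f + SchwartzMap.seminorm ℂ 0 i.2 f))
          (fun _ _ => by positivity) hi
    _ ≤ ∑ i ∈ s, 2 ^ i.1 * ((1 + ‖v‖) * (1 + ‖a‖)) ^ K *
          (SchwartzMap.seminorm ℂ i.1 i.2 f + SchwartzMap.seminorm ℂ 0 i.2 f) := by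
        refine Finset.sum_le_sum fun i hi => ?_
        gcongr
        calc (1 + ‖v a‖) ^ i.1 ≤ ((1 + ‖v‖) * (1 + ‖a‖)) ^ i.1 :=
              pow_le_pow_left₀ (by positivity) h1va _
          _ ≤ ((1 + ‖v‖) * (1 + ‖a‖)) ^ K := by
              refine pow_le_pow_right₀ ?_ (Finset.le_sup (f := Prod.fst) hi)
              have := norm_nonneg v; have := norm_nonneg a
              nlinarith
    _ = Cf * (1 + ‖v‖) ^ K * (1 + ‖a‖) ^ K := by
        rw [mul_pow, Finset.sum_mul, Finset.sum_mul]
        refine Finset.sum_congr rfl fun i _ => ?_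
        ring

/-- **Schwartz weights are polynomially integrable**: `(1 + ‖a‖)^N ‖h(a)‖` is integrable for a
Schwartz function `h`. [folklore] -/
theorem integrable_one_add_norm_pow_mul {E : Type*} [NormedAddCommGroup E] [NormedSpace ℝ E]
    [MeasurableSpace E] [BorelSpace E] [SecondCountableTopology E] {μ : Measure E}
    [μ.HasTemperateGrowth] (h : 𝓢(E, ℂ)) (N : ℕ) :
    Integrable (fun a => (1 + ‖a‖) ^ N * ‖h a‖) μ := by
  have h0 : Integrable (fun a => ‖a‖ ^ 0 * ‖h a‖) μ := h.integrable_pow_mul μ 0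
  have hN : Integrable (fun a => ‖a‖ ^ N * ‖h a‖) μ := h.integrable_pow_mul μ N
  have hsum : Integrable (fun a => 2 ^ N * (‖a‖ ^ 0 * ‖h a‖ + ‖a‖ ^ N * ‖h a‖)) μ :=
    (h0.add hN).const_mul _
  refine hsum.mono' ?_ (Eventually.of_forall fun a => ?_)
  · exact (((continuous_const.add continuous_norm).pow N).mul h.continuous.norm).aestronglyMeasurable
  · rw [Real.norm_of_nonneg (by positivity)]
    have : (1 + ‖a‖) ^ N ≤ 2 ^ N * (1 + ‖a‖ ^ N) := by
      have h := add_pow_le zero_le_one (norm_nonneg a) N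
      rw [one_pow] at h
      exact h.trans (by gcongr <;> norm_num)
    calc (1 + ‖a‖) ^ N * ‖h a‖ ≤ 2 ^ N * (1 + ‖a‖ ^ N) * ‖h a‖ := by gcongr
      _ = 2 ^ N * (‖a‖ ^ 0 * ‖h a‖ + ‖a‖ ^ N * ‖h a‖) := by ring

end Growth

end SchwartzMap
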